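import Literature.NumberTheory.Automorphic.ReciprocityGLnRankOneProofs
import Literature.NumberTheory.Automorphic.BockleHuiIrreducibleGL3AnalyticProofs
import Literature.NumberTheory.Automorphic.ChebotarevArtinRepHolds
import Literature.NumberTheory.GaloisRepresentations.WeakAbelianDirectSummandCyclotomicProofs
import Literature.NumberTheory.GaloisRepresentations.LAdicRepFrobenius
import Literature.NumberTheory.GaloisRepresentations.FramedRepEquivConj
import Literature.NumberTheory.GaloisRepresentations.OddAbsolutelyIrreducibleProofs
import Literature.NumberTheory.Automorphic.GLOneOfHeckeCharacterBJ
import Literature.FieldTheory.AlgClosed.PadicAlgClEquivComplex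
import HarnessLib

/-!
# `GaloisRepOfRegularAlgebraic` (stmt-Langlands-10785): `IsRegularAlgebraic` is load-bearing

Negative lemma for the crux `GaloisRepOfRegularAlgebraic` of route `IrreducibilityBySelfDuality`
(= lang.S27 verbatim).  `galoisRepOfRegularAlgebraic_false_without_regularAlgebraic` proves FALSE,
sorry-free, the text of the crux with the hypothesis `π.1.IsRegularAlgebraic →` deleted (named
`GaloisRepOfRegularAlgebraicWithoutRegularAlgebraic` in the crux work-file
`Cruxes/GaloisRepOfRegularAlgebraic/Disproof.lean`; written out inline here to keep this file
definition-free), i.e. "every cuspidal `π` on `GL_n` over a totally real or CM field has compatible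
`ℓ`-adic Galois representations".

Witness: `n = 1`, `K = ℚ`, `π = π_{‖·‖^{1/2}}`, the Borel–Jacquet datum of the Hecke character
`‖·‖^{1/2}` (a norm twist which is NOT of type `A₀`).  Its Satake parameter at a good place `v` is
`{(N v)^{-1/2}}`, so the predicted arithmetic-Frobenius value is `s_v = ι⁻¹(√(N v))`, with
`s_v² = N v = χ_ℓ(Frob_v)`.  If `r : Γ_ℚ → GL₁(ℚ̄_ℓ)` were compatible, the rank-one representation
`r² = det r · det r` and the `ℓ`-adic cyclotomic character `χ_ℓ` would be unramified with the same
Frobenius polynomial `X - N v` at all but finitely many `v`, hence EQUIVALENT (Chebotarev + Brauer–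
Nesbitt in rank one: `nonempty_equiv_of_hasFrobCharpolyAt_eventually chebotarev_artinRep_holds`,
PROVED in the tree), hence equal as characters (`1 × 1` conjugation is trivial); at a complex
conjugation `c` (`exists_isComplexConjugation`, `c² = 1`) this gives
`1 = r(c²)₀₀ = (r c)₀₀² = χ_ℓ(c) = -1` (`cyclotomicCharacter_of_isComplexConjugation`) in `ℚ̄_ℓ`,
absurd in characteristic `0`.  This is the classical fact that `‖·‖^{1/2}` (equivalently a square root
of the cyclotomic character over `ℚ`) has no `ℓ`-adic avatar; it shows that the archimedean
hypothesis of the crux is used by ANY proof, already in rank one.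

All inputs are PROVED tree theorems; `ι` exists (`PadicAlgCl.nonempty_ringEquiv_complex`).

Refs: J.-P. Serre, *Abelian ℓ-adic representations* (1968), Ch. I §2.3 (Chebotarev uniqueness), Ch.
III §2–3 (locally algebraic characters are exactly those of Hecke characters of type `A₀`); A. Weil
(1956) §1; J. Tate, Corvallis (1979) §2 (`‖·‖^s` is of type `A₀` iff `s ∈ ℤ`).
-/

noncomputable section

set_option linter.dupNamespace false -- project-wide option (lakefile weak.linter.dupNamespace); `Summit.Langlands.Langlands` is the mandated namespace (D-0017)

open scoped MatrixGroups Matrix NumberField Polynomial Classical NNReal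
open NumberField IsDedekindDomain Field Polynomial Filter
open Literature.NumberTheory.Automorphic Literature.NumberTheory.GaloisRepresentations

namespace Summit.Langlands.Langlands.Theorems.GaloisRepOfRegularAlgebraic.Negative

/-! ### `1 × 1` bookkeeping -/

/-- `GL₁` is commutative: conjugation is trivial on `1 × 1` invertible matrices. [folklore] -/
theorem gl_one_conj_eq {A : Type*} [CommRing A] (P g : GL (Fin 1) A) : P * g * P⁻¹ = g := by
  have hcomm : P * g = g * P := by
    refine Units.ext (Matrix.ext fun i j => ?_)
    rw [Subsingleton.elim i 0, Subsingleton.elim j 0]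
    simp only [Units.val_mul, Matrix.mul_apply, Fin.sum_univ_one]
    exact mul_comm _ _
  rw [hcomm, mul_inv_cancel_right]

/-- Powers of a `1 × 1` invertible matrix, entrywise. [folklore] -/
theorem gl_one_pow_apply' {A : Type*} [CommRing A] (g : GL (Fin 1) A) (k : ℕ) :
    ((g ^ k : GL (Fin 1) A) : Matrix (Fin 1) (Fin 1) A) 0 0 =
      (((g : GL (Fin 1) A) : Matrix (Fin 1) (Fin 1) A) 0 0) ^ k := by
  induction k with
  | zero => simp
  | succ k ih => rw [pow_succ, Units.val_mul, Matrix.mul_apply, Fin.sum_univ_one, ih, pow_succ]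

/-! ### The Hecke character `‖·‖^{1/2}` -/

/-- **There is a Hecke character `θ = ‖·‖^{1/2}`**: `θ(x) = √‖x‖` for every idele `x` (continuous:
`continuous_ideleNorm_holds` and continuity of `√·`; trivial on `Kˣ` by the product formula
`ideleNorm_principal`).  It is a norm twist (`z = 1/2`), hence unramified everywhere with
`θ(ϖ_v) = (N v)^{-1/2}`.  Tate (1950) §4.3: the quasi-characters trivial on `𝕀¹_K` are the `‖·‖^s`.
[cite: TateThesis1967, §4.3, p. 339] -/
theorem exists_halfNormCharacter (K : Type) [Field K] [NumberField K] :
    ∃ θ : HeckeCharacter K, ∀ x : ideleGroup K, ((θ x : ℂˣ) : ℂ) =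
      (Real.sqrt (Literature.NumberTheory.GaloisRepresentations.ideleNorm x) : ℂ) := by
  let f : ℝ≥0 →* ℂ :=
    (Complex.ofRealHom : ℝ →+* ℂ).toMonoidHom.comp
      (NNReal.toRealHom.toMonoidHom.comp (NNReal.sqrtHom : ℝ≥0 →*₀ ℝ≥0).toMonoidHom)
  have hf : Continuous f :=
    Complex.continuous_ofReal.comp (NNReal.continuous_coe.comp NNReal.continuous_sqrt)
  have hfapply : ∀ y : ℝ≥0, f y = ((NNReal.sqrt y : ℝ) : ℂ) := fun y => rfl
  have hcont : Continuous ((Units.map f).comp (ideleNormUnits K)) := by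
    refine (Continuous.units_map _ hf).comp ?_
    exact Units.continuous_iff.mpr ⟨continuous_ideleNorm_holds K,
      ((continuous_ideleNorm_holds K).comp continuous_inv).congr fun _ => rfl⟩
  let θc : ideleGroup K →ₜ* ℂˣ :=
    { toMonoidHom := (Units.map f).comp (ideleNormUnits K), continuous_toFun := hcont }
  have hθc : ∀ x, ((θc x : ℂˣ) : ℂ) = f (IdeleClassGroup.ideleNorm K x) := fun x => rfl
  refine ⟨⟨θc, fun x hx => ?_⟩, fun x => ?_⟩
  · refine Units.ext ?_
    rw [hθc, ideleNorm_principal hx, map_one, Units.val_one]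
  · change ((θc x : ℂˣ) : ℂ) = _
    rw [hθc, hfapply, Real.coe_sqrt, coe_ideleNorm]

/-! ### The negative lemma -/

/-- **Any proof of `GaloisRepOfRegularAlgebraic` must use `IsRegularAlgebraic`**: the crux with the
hypothesis `π.1.IsRegularAlgebraic →` deleted is FALSE (witness `π_{‖·‖^{1/2}}` on `GL₁/ℚ`; see the
module docstring).  [cite: SerreAbelianLadic1968, Ch. I §2.3 and Ch. III §3] -/
theorem galoisRepOfRegularAlgebraic_false_without_regularAlgebraic :
    ¬ ∀ (n : ℕ) (K : Type) [Field K] [NumberField K] (hcpt : isCompact_glFiniteIntegralLevel n K),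
      (IsTotallyReal K ∨ IsCMField K) → ∀ (π : CuspidalAutomorphicRepData n K hcpt),
      ∀ (ℓ : ℕ) [Fact ℓ.Prime] (ι : PadicAlgCl ℓ ≃+* ℂ),
      ∃ r : FramedGaloisRep K (PadicAlgCl ℓ) n, r.toGaloisRep.IsSemisimple ∧
        ∀ (v : HeightOneSpectrum (𝓞 K)) (α : Multiset ℂ), π.1.HasSatakeParamAt v α →
          ((ℓ : ℕ) : 𝓞 K) ∉ v.asIdeal →
            r.IsUnramifiedAt v ∧
              r.HasFrobCharpolyAt v (arithFrobPolyOfSatake ι v.residueCard n α) := by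
  intro H
  -- the datum of `‖·‖^{1/2}` on `GL₁/ℚ`, with its Satake parameters almost everywhere
  have hcpt : isCompact_glFiniteIntegralLevel 1 ℚ := isCompact_glFiniteIntegralLevel_holds 1 ℚ
  obtain ⟨θ, hθ⟩ := exists_halfNormCharacter ℚ
  obtain ⟨τ, hτ⟩ := exists_cuspidal_glOne_hasSatakeParamAt_valueAtUniformizer hcpt θ
  -- the prime `ℓ = 2` and any `ι`
  haveI : Fact (Nat.Prime 2) := ⟨Nat.prime_two⟩
  obtain ⟨ι⟩ := PadicAlgCl.nonempty_ringEquiv_complex 2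
  obtain ⟨r, -, hr⟩ := H 1 ℚ hcpt (Or.inl inferInstance) τ 2 ι
  -- the value of `θ` at uniformizers: `(N v)^{-1/2}`
  have hθtwist : θ.IsNormTwist := by
    refine ⟨((1 / 2 : ℝ) : ℂ), fun x => ?_⟩
    rw [hθ x, Real.sqrt_eq_rpow, Complex.ofReal_cpow (by rw [← coe_ideleNorm]; exact NNReal.coe_nonneg _)]
  have hval : ∀ v : HeightOneSpectrum (𝓞 ℚ),
      θ.valueAtUniformizer v = ((Real.sqrt (v.residueCard : ℝ) : ℝ) : ℂ)⁻¹ := fun v => by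
    rw [HeckeCharacter.valueAtUniformizer, HeckeCharacter.localComponent_apply, hθ,
      Literature.NumberTheory.GaloisRepresentations.ideleNorm_localUnits, HeckeCharacter.norm_uniformizer,
      Real.sqrt_inv, Complex.ofReal_inv]
    rfl
  -- the predicted Frobenius value `s_v = ι⁻¹ √(N v)` squares to `N v`
  have hsq : ∀ v : HeightOneSpectrum (𝓞 ℚ),
      ι.symm ((Real.sqrt (v.residueCard : ℝ) : ℝ) : ℂ) * ι.symm ((Real.sqrt (v.residueCard : ℝ) : ℝ) : ℂ)
        = (v.residueCard : PadicAlgCl 2) := fun v => by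
    rw [← map_mul, ← Complex.ofReal_mul, Real.mul_self_sqrt (Nat.cast_nonneg _),
      Complex.ofReal_natCast, map_natCast]
  -- `r² = det r · det r` as a rank-one framed representation
  set sqHom : (PadicAlgCl 2)ˣ →ₜ* (PadicAlgCl 2)ˣ :=
    { toMonoidHom := powMonoidHom 2, continuous_toFun := continuous_pow 2 } with hsqdef
  set r2 : FramedGaloisRep ℚ (PadicAlgCl 2) 1 :=
    ContinuousMonoidHom.comp
      (FramedRep.unitsContinuousMulEquivOfUnique (Fin 1) (PadicAlgCl 2) :
        (PadicAlgCl 2)ˣ →ₜ* GL (Fin 1) (PadicAlgCl 2))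
      (sqHom.comp (FramedRep.det r)) with hr2def
  have hr2 : ∀ σ : absoluteGaloisGroup ℚ,
      ((r2 σ : GL (Fin 1) (PadicAlgCl 2)) : Matrix (Fin 1) (Fin 1) (PadicAlgCl 2)) 0 0 =
        ((r σ : GL (Fin 1) (PadicAlgCl 2)) : Matrix (Fin 1) (Fin 1) (PadicAlgCl 2)) 0 0 ^ 2 := by
    intro σ
    simp only [hr2def, hsqdef, ContinuousMonoidHom.comp_toFun, FramedRep.det_apply]
    rw [show (FramedRep.unitsContinuousMulEquivOfUnique (Fin 1) (PadicAlgCl 2) :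
        (PadicAlgCl 2)ˣ →ₜ* GL (Fin 1) (PadicAlgCl 2)) = fun a =>
          FramedRep.unitsContinuousMulEquivOfUnique (Fin 1) (PadicAlgCl 2) a from rfl]
    simp only [FramedRep.unitsContinuousMulEquivOfUnique_apply_coe]
    change (((powMonoidHom 2) (Matrix.GeneralLinearGroup.det (r σ)) : (PadicAlgCl 2)ˣ) :
      PadicAlgCl 2) = _
    rw [powMonoidHom_apply, Units.val_pow_eq_pow_val, Matrix.GeneralLinearGroup.val_det_apply,
      Matrix.det_fin_one]
  -- the cyclotomic character `ψ = χ_2 : Γ_ℚ → GL₁(ℚ̄₂)`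
  obtain ⟨ψ, hψ⟩ := FramedGaloisRep.exists_cyclotomic_padicAlgCl ℚ 2
  -- `r²` and `ψ` have the same Frobenius polynomial `X - N v` at almost every `v`
  have hgood : ∀ᶠ v : HeightOneSpectrum (𝓞 ℚ) in cofinite,
      r2.IsUnramifiedAt v ∧ ψ.IsUnramifiedAt v ∧
        ∃ P : Polynomial (PadicAlgCl 2), r2.HasFrobCharpolyAt v P ∧ ψ.HasFrobCharpolyAt v P := by
    filter_upwards [FramedGaloisRep.eventually_natCast_not_mem ℚ 2, hτ] with v hv hsat
    obtain ⟨hunr, hfrob⟩ := hr v _ hsat hv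
    rw [hval v, arithFrobPolyOfSatake_one, Multiset.map_singleton, Multiset.prod_singleton,
      inv_inv] at hfrob
    have hentry := (r.hasFrobCharpolyAt_iff_of_rank_one v _).mp hfrob
    refine ⟨?_, ψ.isUnramifiedAt_of_cyclotomic hψ hv, X - C (v.residueCard : PadicAlgCl 2), ?_,
      ψ.hasFrobCharpolyAt_natCast_of_cyclotomic hψ hv⟩
    · intro 𝔓 h𝔓 σ hσ
      have h1 : r σ = 1 := hunr 𝔓 h𝔓 σ hσ
      simp only [hr2def, ContinuousMonoidHom.comp_toFun, FramedRep.det_apply, h1, map_one]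
    · refine (r2.hasFrobCharpolyAt_iff_of_rank_one v _).mpr fun 𝔓 h𝔓 Φ hΦ => ?_
      rw [hr2 Φ, hentry 𝔓 h𝔓 Φ hΦ, pow_two, hsq v]
  -- hence they are equivalent (Chebotarev + Brauer–Nesbitt, rank one), hence equal as characters
  obtain ⟨e⟩ := FramedGaloisRep.nonempty_equiv_of_hasFrobCharpolyAt_eventually
    chebotarev_artinRep_holds r2 ψ (FramedGaloisRep.isSemisimple_toGaloisRep_of_rank_one r2)
    (FramedGaloisRep.isSemisimple_toGaloisRep_of_rank_one ψ) hgood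
  obtain ⟨P, hP⟩ := FramedRep.exists_eq_conj_of_equiv r2 ψ e
  have heq : ∀ σ : absoluteGaloisGroup ℚ, ψ σ = r2 σ := fun σ => by
    rw [hP, FramedRep.conj_apply, gl_one_conj_eq]
  -- evaluate at a complex conjugation
  obtain ⟨c, hc⟩ := exists_isComplexConjugation (Rat.castHom ℝ)
  have hψc : ((ψ c : GL (Fin 1) (PadicAlgCl 2)) : Matrix (Fin 1) (Fin 1) (PadicAlgCl 2)) 0 0 = -1 := by
    rw [hψ c, GaloisRep.cyclotomicCharacter_of_isComplexConjugation 2 hc]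
    simp
  have hrc : ((r2 c : GL (Fin 1) (PadicAlgCl 2)) : Matrix (Fin 1) (Fin 1) (PadicAlgCl 2)) 0 0 = 1 := by
    rw [hr2 c, ← gl_one_pow_apply', ← map_pow, hc.sq_eq_one, map_one]
    simp
  have h : (-1 : PadicAlgCl 2) = 1 := by rw [← hψc, heq c, hrc]
  have h2 : (2 : PadicAlgCl 2) = 0 := by linear_combination -h
  exact two_ne_zero h2

end Summit.Langlands.Langlands.Theorems.GaloisRepOfRegularAlgebraic.Negative

end
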